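import Summits.AtomisticToContinuum.Crystallization.Theorems.ChartedZeroExcessLayeredLatticeLiouvilleXQ

/-!
# Zero-excess layered lattice Liouville — part XR (lens-2 g59, node «SBGlueC4f»): the STEP of the tower and the tower down to `nlo`

Critic rows 1133/1135 (C4 «drift budget `C_R·Σm ≤ min(c₀,κ₀)/2` re-verified at every step; the profile is inherited»), leaf (2)
`SubWindowBudgetGlueBPG` of `stmt-AtomisticToContinuum-26636`.

* XR.1 `TowerInv.modeProfile` — the mode `M_ℓ` of XQ `modeStep` is ADMISSIBLE for re-charting (`m_M ≤ m₀`, `C_R m_M² + ε m_M ≤ m_M`,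
  `m_M ≤ √(Cm p_ℓ)`) and any field within `2·E(φ_ℓ − M_ℓ)(B_{n_{ℓ+1}}) + 54(C_R m_M² + ε m_M)²·#B_{n_{ℓ+1}}` inherits the profile
  `p_{ℓ+1}·#B_{n_{ℓ+1}}` (XN `mode_size_le` / `corr_le` / `energy_le` with the history bound XQ `hist` and the far bound XQ `F_le`).
* XR.2 `TowerInv.newLevel` — RE-CHARTING (`TH.RC` = `EquilChartStrainP` at the floors) + XK (E4) `idxEnergy_pullDisp_iterate_le`: the new level
  satisfies `LevOK (ℓ+1)` with `DM' = DM + m_M ≤ μpart(ℓ+1)`, `D' = D + m_M + (C_R m_M² + ε m_M) ≤ 2DM'`, and the drift-Lipschitz facts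
  against every earlier level (XK `isIdxLipschitz_drift_succ`).
* XR.3 ★ `TowerInv.succ` / `TH.tower` — the tower invariant propagates `ℓ → ℓ+1` while `n_{ℓ+1} ≥ nlo`, hence holds at every level `ℓ` with
  `n_ℓ ≥ nlo` (induction from XO `towerInv_zero`).
-/

noncomputable section

open scoped BigOperators InnerProductSpace RealInnerProductSpace
open Set Function Metric
open Summit.AtomisticToContinuum.Crystallization.Theorems.ChartedPlanarOrderRigidityDoor (E3 IsClean IsNash atomsIn)
open Summit.AtomisticToContinuum.Crystallization.Theorems.ChartedPlanarOrderDensityDichotomy (μS IsSep nK nK_nonneg)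
open Summit.AtomisticToContinuum.Crystallization.Theorems.ChartedPlanarOrderCleanScaleP (IsCleanP IsDoorSetP isCleanP_one_iff)
open Summit.AtomisticToContinuum.Crystallization.Theorems.ChartedPlanarOrderMesoCut (LayeredHom)
open Summit.AtomisticToContinuum.Crystallization.Theorems.ChartedPlanarOrderDoorLayered (Layered layeredHom_eq_layered atomsIn_subset)
open Summit.AtomisticToContinuum.Crystallization.Theorems.ChartedPlanarOrderDoorLayeredOsc (IsTwoShellAffineGood)

namespace Summit.AtomisticToContinuum.Crystallization.Theorems.ChartedZeroExcessLayeredLatticeLiouville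

section Step

variable {K : SBK} {S : Set E3} {Ψ₀ : E3 → E3} {st₀ : Lev} {x : E3} {X₀ : Cell 2 × ℤ} {ℓ : ℕ} {lev : ℕ → Lev}

/-! ### XR.1  The profile of the step -/

/-- the mode of level `ℓ` is admissible for re-charting, and the next level inherits the profile. -/
theorem TowerInv.modeProfile (T : TH K S Ψ₀ st₀ x X₀) (hT : TowerInv K S Ψ₀ st₀ X₀ ℓ lev) (hℓ1 : K.nlo ≤ K.n (ℓ + 1)) :
    ∃ M : Cell 2 → ℤ → E3, ∃ mM : ℝ, IsTruncMode K.ϱ (chartGen₁ (lev ℓ).L) (chartGen₂ (lev ℓ).L) (lev ℓ).w₁ M ∧ IsIdxLipschitz mM M ∧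
      0 ≤ mM ∧ mM ≤ K.m₀ ∧ mM ≤ Real.sqrt (K.Cm * K.p ℓ) ∧ K.CR * mM ^ 2 + K.ε * mM ≤ mM ∧
      ∀ E' : ℝ, E' ≤ 2 * idxEnergy (levφ S Ψ₀ st₀ (lev ℓ) - M) (idxBall X₀ (K.n (ℓ + 1))) +
          54 * (K.CR * mM ^ 2 + K.ε * mM) ^ 2 * ((idxBall X₀ (K.n (ℓ + 1))).ncard : ℝ) →
        E' ≤ K.p (ℓ + 1) * ((idxBall X₀ (K.n (ℓ + 1))).ncard : ℝ) := by
  have hK := T.ok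
  have hℓ : K.nlo ≤ K.n ℓ := hℓ1.trans (SBK.n_succ_le hK ℓ)
  have htC := hK.htC
  obtain ⟨M, mM, cE, hM, hmM0, hmM, hcE0, hcEle, hsize, hexc⟩ := hT.modeStep T hℓ1
  obtain ⟨pπ, Δ, hpπ0, hpπ, hΔ, hEmb⟩ := hT.hist T hℓ1
  have hFb := T.F_le hℓ
  have hNn1 : 0 < ((idxBall X₀ (K.n (ℓ + 1))).ncard : ℝ) :=
    lt_of_lt_of_le (by have := SBK.n_pos hK (ℓ + 1); positivity) (cube_le_ncard_idxBall X₀ (SBK.n_pos hK _).le)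
  have hN10 : ((idxBall X₀ (K.n (ℓ + 1))).ncard : ℝ) ≤ ((idxBall X₀ (K.n ℓ)).ncard : ℝ) := by
    exact_mod_cast Set.ncard_le_ncard (idxBall_mono X₀ (SBK.n_succ_le hK ℓ)) (finite_idxBall X₀ _)
  have hN01 : ((idxBall X₀ (K.n ℓ)).ncard : ℝ) ≤ K.rN * ((idxBall X₀ (K.n (ℓ + 1))).ncard : ℝ) := by
    have h := ncard_idxBall_le_ratio X₀ (SBK.one_le_n hK hℓ) htC
    rw [← SBK.n_succ] at h
    exact h
  have hEn0 := idxEnergy_nonneg (levφ S Ψ₀ st₀ (lev ℓ)) (idxBall X₀ (K.n ℓ))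
  have hEn := (hT.levOK ℓ le_rfl).energy
  have hcE' := SBK.cE_le_cEb hK hcEle hEmb hFb
  have hcEb0 := SBK.cEb_nonneg hK ℓ (Δ := Δ) hpπ0
  have hcEbP := SBK.cEb_le hK hℓ1 hpπ hΔ
  have hmM2 := SBK.mode_size_le hK hNn1 hN01 hEn0 hcE0 hsize hEn hcE' hcEb0 hcEbP
  obtain ⟨hL2, hLc, hm₀, hsq⟩ := SBK.corr_le hK hℓ hmM0 hmM2
  exact ⟨M, mM, hM, hmM, hmM0, hm₀, hsq, hLc, fun E' hE' => SBK.energy_le hK hNn1 hN10 hexc hE' hEn hcE' hcEb0 hcEbP hL2⟩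

/-! ### XR.2  Re-charting: the new level -/

/-- symmetry of an index-Lipschitz difference field. -/
theorem isIdxLipschitz_sub_symm {m : ℝ} {f g : Cell 2 → ℤ → E3} (h : IsIdxLipschitz m (fun γ k => f γ k - g γ k)) :
    IsIdxLipschitz m (fun γ k => g γ k - f γ k) := by
  intro X Y
  have e : ‖(g Y.1 Y.2 - f Y.1 Y.2) - (g X.1 X.2 - f X.1 X.2)‖ = ‖(f Y.1 Y.2 - g Y.1 Y.2) - (f X.1 X.2 - g X.1 X.2)‖ := by
    rw [← norm_neg]; congr 1; abel
  show ‖(g Y.1 Y.2 - f Y.1 Y.2) - (g X.1 X.2 - f X.1 X.2)‖ ≤ m * dist X Y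
  rw [e]; exact h X Y

/-- ★ RE-CHARTING: the new level `ℓ+1` of the tower (module docstring XR.2). -/
theorem TowerInv.newLevel (T : TH K S Ψ₀ st₀ x X₀) (hT : TowerInv K S Ψ₀ st₀ X₀ ℓ lev) (hℓ1 : K.nlo ≤ K.n (ℓ + 1)) :
    ∃ nl : Lev, LevOK K S Ψ₀ st₀ X₀ (ℓ + 1) nl ∧
      (∀ k, k ≤ ℓ → IsIdxLipschitz (nl.D - (lev k).D) (fun γ m => lsite (chartGen₁ nl.L) (chartGen₂ nl.L) nl.w₁ γ m -
        lsite (chartGen₁ (lev k).L) (chartGen₂ (lev k).L) (lev k).w₁ γ m) ∧ (lev k).D ≤ nl.D) ∧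
      nl.D - (lev ℓ).D ≤ 2 * Real.sqrt (K.Cm * K.p ℓ) := by
  have hK := T.ok
  have hℓ : K.nlo ≤ K.n ℓ := hℓ1.trans (SBK.n_succ_le hK ℓ)
  have hOℓ := hT.levOK ℓ le_rfl
  obtain ⟨-, hcfl, hCfl, hκfl, hcpos, hD2, hCR0⟩ := hOℓ.floors T hℓ
  obtain ⟨M, mM, hM, hmM, hmM0, hm₀, hsq, hLc, hE⟩ := hT.modeProfile T hℓ1
  have hc₀ := hK.hc₀; have hCR := hK.hCR; have hε := hK.hε
  have hμ1 : (lev ℓ).DM + mM ≤ K.μpart (ℓ + 1) := by rw [SBK.μpart_succ]; exact add_le_add hOℓ.DMle hsq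
  have hμM : (lev ℓ).DM + mM ≤ K.μM := hμ1.trans (SBK.μpart_le_μM hK hℓ1)
  have hCRμ : K.CR * ((lev ℓ).DM + mM) ≤ K.CR * K.μM := mul_le_mul_of_nonneg_left hμM (by linarith)
  have hds := hK.hds; have hdν := hK.hdν; have hdc := hK.hdc
  have hLc0 : 0 ≤ K.CR * mM ^ 2 + K.ε * mM := by positivity
  obtain ⟨L', w', w₁', hch', hnear', hlay', hcr', hT', hco', hAM⟩ := T.RC (1 / 50 + K.CR * (lev ℓ).DM) (2 + K.CR * (lev ℓ).DM)
    (1 / 2000 + K.CR * (lev ℓ).DM) (K.κ₀ - K.CR * (lev ℓ).DM) (K.c₀ - K.CR * (lev ℓ).DM) (K.C₁ + K.CR * (lev ℓ).DM) mM hκfl hcfl hCfl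
    hmM0 hm₀ (by linarith) (by linarith) (by linarith) (lev ℓ).L (lev ℓ).w (lev ℓ).w₁ hOℓ.chart hOℓ.near hOℓ.lay hOℓ.cryst hOℓ.tame
    hOℓ.coer M hM hmM
  have hc'pos : 0 < K.c₀ - K.CR * (lev ℓ).DM - K.CR * mM := by linarith
  -- (E4): the next iterate on the next ball
  have hE4 := idxEnergy_pullDisp_iterate_le T.bij₀ T.c₀_pos T.cryst₀ hcpos hOℓ.cryst hc'pos hcr' hAM (idxBallF X₀ (K.n (ℓ + 1)))
  have hcard : ((idxBallF X₀ (K.n (ℓ + 1))).card : ℝ) = ((idxBall X₀ (K.n (ℓ + 1))).ncard : ℝ) := by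
    rw [← coe_idxBallF, Set.ncard_coe_finset]
  rw [coe_idxBallF, hcard, ← levφ_def] at hE4
  have hE' := hE _ hE4
  refine ⟨⟨L', w', w₁', (lev ℓ).D + mM + (K.CR * mM ^ 2 + K.ε * mM), (lev ℓ).DM + mM⟩, ⟨?_, ?_, hlay', ?_, ?_, ?_, ?_, hμ1, ?_, ?_, ?_⟩,
    fun k hk => ⟨?_, ?_⟩, ?_⟩
  · show IsEquilChart K.a (1 / 50 + K.CR * ((lev ℓ).DM + mM)) (2 + K.CR * ((lev ℓ).DM + mM)) L' w'
    rw [show 1 / 50 + K.CR * ((lev ℓ).DM + mM) = 1 / 50 + K.CR * (lev ℓ).DM + K.CR * mM by ring,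
      show 2 + K.CR * ((lev ℓ).DM + mM) = 2 + K.CR * (lev ℓ).DM + K.CR * mM by ring]
    exact hch'
  · show IsEnergyNear (1 / 2000 + K.CR * ((lev ℓ).DM + mM)) (LayeredHom (L' : E3 →L[ℝ] E3) w')
    rw [show 1 / 2000 + K.CR * ((lev ℓ).DM + mM) = 1 / 2000 + K.CR * (lev ℓ).DM + K.CR * mM by ring]
    exact hnear'
  · show IsLayeredCrystal (K.c₀ - K.CR * ((lev ℓ).DM + mM)) (chartGen₁ L') (chartGen₂ L') w₁'
    rw [show K.c₀ - K.CR * ((lev ℓ).DM + mM) = K.c₀ - K.CR * (lev ℓ).DM - K.CR * mM by ring]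
    exact hcr'
  · show IsTameIndexing (K.C₁ + K.CR * ((lev ℓ).DM + mM)) (chartGen₁ L') (chartGen₂ L') w₁'
    rw [show K.C₁ + K.CR * ((lev ℓ).DM + mM) = K.C₁ + K.CR * (lev ℓ).DM + K.CR * mM by ring]
    exact hT'
  · show CoerciveZ (layeredKernel (chartGen₁ L') (chartGen₂ L') w₁') (K.κ₀ - K.CR * ((lev ℓ).DM + mM))
    rw [show K.κ₀ - K.CR * ((lev ℓ).DM + mM) = K.κ₀ - K.CR * (lev ℓ).DM - K.CR * mM by ring]
    exact hco'
  · show 0 ≤ (lev ℓ).DM + mM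
    have := hOℓ.DM0; positivity
  · show 0 ≤ (lev ℓ).D + mM + (K.CR * mM ^ 2 + K.ε * mM)
    have := hOℓ.D0; positivity
  · show (lev ℓ).D + mM + (K.CR * mM ^ 2 + K.ε * mM) ≤ 2 * ((lev ℓ).DM + mM)
    have := hOℓ.Dle; linarith
  · show idxEnergy (levφ S Ψ₀ st₀ ⟨L', w', w₁', (lev ℓ).D + mM + (K.CR * mM ^ 2 + K.ε * mM), (lev ℓ).DM + mM⟩)
      (idxBall X₀ (K.n (ℓ + 1))) ≤ K.p (ℓ + 1) * ((idxBall X₀ (K.n (ℓ + 1))).ncard : ℝ)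
    rw [levφ_def]
    exact hE'
  · show IsIdxLipschitz ((lev ℓ).D + mM + (K.CR * mM ^ 2 + K.ε * mM) - (lev k).D) (fun γ m => lsite (chartGen₁ L') (chartGen₂ L') w₁' γ m -
        lsite (chartGen₁ (lev k).L) (chartGen₂ (lev k).L) (lev k).w₁ γ m)
    rw [show (lev ℓ).D + mM + (K.CR * mM ^ 2 + K.ε * mM) - (lev k).D = ((lev ℓ).D - (lev k).D) + mM + (K.CR * mM ^ 2 + K.ε * mM)
      by ring]
    exact isIdxLipschitz_drift_succ (hT.lip ℓ le_rfl k hk).1 hmM hAM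
  · show (lev k).D ≤ (lev ℓ).D + mM + (K.CR * mM ^ 2 + K.ε * mM)
    have := (hT.lip ℓ le_rfl k hk).2; linarith
  · show (lev ℓ).D + mM + (K.CR * mM ^ 2 + K.ε * mM) - (lev ℓ).D ≤ 2 * Real.sqrt (K.Cm * K.p ℓ)
    linarith

/-! ### XR.3  The step and the tower -/

/-- ★ the STEP `ℓ → ℓ+1` of the tower (module docstring XR.3). [this file, g59] -/
theorem TowerInv.succ (T : TH K S Ψ₀ st₀ x X₀) (hT : TowerInv K S Ψ₀ st₀ X₀ ℓ lev) (hℓ1 : K.nlo ≤ K.n (ℓ + 1)) :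
    ∃ lev' : ℕ → Lev, TowerInv K S Ψ₀ st₀ X₀ (ℓ + 1) lev' ∧ ∀ i, i ≤ ℓ → lev' i = lev i := by
  obtain ⟨nl, hOK, hlip, hstep⟩ := hT.newLevel T hℓ1
  refine ⟨fun i => if i ≤ ℓ then lev i else nl, ⟨?_, ?_, ?_, ?_⟩, fun i hi => if_pos hi⟩
  · simp only [Nat.zero_le, if_true]; exact hT.zero
  · intro i hi
    rcases Nat.lt_or_ge ℓ i with h | h
    · have hi' : i = ℓ + 1 := by omega
      subst hi'
      simp only [show ¬ (ℓ + 1 ≤ ℓ) by omega, if_false]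
      exact hOK
    · simp only [h, if_true]
      exact hT.levOK i h
  · intro i hi k hk
    rcases Nat.lt_or_ge ℓ i with h | h
    · have hi' : i = ℓ + 1 := by omega
      subst hi'
      rcases Nat.lt_or_ge ℓ k with h' | h'
      · have hk' : k = ℓ + 1 := by omega
        subst hk'
        simp only [show ¬ (ℓ + 1 ≤ ℓ) by omega, if_false, sub_self]
        exact ⟨fun X Y => by simp, le_rfl⟩
      · simp only [show ¬ (ℓ + 1 ≤ ℓ) by omega, if_false, h', if_true]
        exact hlip k h'
    · simp only [h, show k ≤ ℓ by omega, if_true]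
      exact hT.lip i h k hk
  · intro i hi
    rcases Nat.lt_or_ge i ℓ with h | h
    · simp only [show i + 1 ≤ ℓ by omega, h.le, if_true]
      exact hT.step i h
    · have hi' : i = ℓ := by omega
      subst hi'
      simp only [show ¬ (i + 1 ≤ i) by omega, if_false, le_refl, if_true]
      exact hstep

/-- ★ the TOWER down to `nlo`: the invariant holds at every level `ℓ` with `n_ℓ ≥ nlo` (module docstring XR.3). [this file, g59] -/
theorem TH.tower (T : TH K S Ψ₀ st₀ x X₀) : ∀ ℓ : ℕ, K.nlo ≤ K.n ℓ → ∃ lev : ℕ → Lev, TowerInv K S Ψ₀ st₀ X₀ ℓ lev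
  | 0, _ => ⟨fun _ => st₀, T.towerInv_zero⟩
  | ℓ + 1, h => by
    obtain ⟨lev, hT⟩ := TH.tower T ℓ (h.trans (SBK.n_succ_le T.ok ℓ))
    obtain ⟨lev', hT', -⟩ := hT.succ T h
    exact ⟨lev', hT'⟩

end Step

end Summit.AtomisticToContinuum.Crystallization.Theorems.ChartedZeroExcessLayeredLatticeLiouville

end
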